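import Mathlib
import HarnessLib
import Summits.ResolutionOfSingularities.ResolutionOfSingularities.Theorems.WildQuotientsWildQuotientResolutionS1aNpFrame

/-!
# S1a — K-FREE FRAME, (F-T5): the carried formal locus lies in the fixed-point set of `g₀` (`fLocus_subset_fixedPoints`)

[OURS · L1 W4.5c · lead-1 g12; plan-1 RULING R-F15 (2) «(F-T5) `fLocus_subset_fixedPoints : 𝔄.fLocus ⊆ {u | (ρ… g₀).hom.base u = u}` for ANY
`NodeAtlasData` (at a non-fixed `u` and any chart `∋ u`: `aug ∩ 𝒜0 ⊄` any prime of the finite orbit `{σ^i 𝔭_u}` ⇒ prime avoidance gives `c ∈ aug ∩ 𝒜0` off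
the orbit ⇒ `b := Π σ^i c` invariant, `b(u) ≠ 0`, `b ∈ aug` ⇒ `aug·B_b = (1)` ⇒ PrincipalNear)», A-KF v1 §1.4] — NOT statements of the manuscript; counted 0;
AI-level work, weaker than expert review. Crux stmt-ResolutionOfSingularities-17941 `CyclicQuotientFourfolds`, line `s1a-logminvertex` v12 (`stub_reachLowerInF`).

* `aut_inv_base_eq_of_forall_sub_mem`, `aut_base_eq_of_forall_sub_mem` — on a `G`-stable affine open: if every increment `g·t − t` of a section vanishes
  at `w`, then `g` FIXES `w` (schemes are T₀; basic opens through `w` and `g⁻¹w`);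
* `exists_invariant_mem_incrementIdeal` — at a point `u` NOT fixed by `g₀` (`G = ⟨g₀⟩` finite): an INVARIANT section `b` in the ideal generated by the
  increments `g₀·t − t`, invertible at `u` (prime avoidance over the orbit + the norm `Π_g g·c`);
* ★ `NodeData.principalNear_of_not_fixed` — every node chart through a non-fixed point is PRINCIPAL near it (the augmentation ideal becomes `(1)` after
  inverting `e b`);
* ★ `NodeAtlasData.fLocus_subset_fixedPoints` — (F-T5): `F_𝔄 ⊆ Fix(g₀)` for EVERY atlas; `fLocus_eq_empty_of_forall_not_fixed` (free actions: `F = ∅`).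
-/

set_option linter.dupNamespace false

noncomputable section

universe u

open CategoryTheory Limits AlgebraicGeometry TopologicalSpace Topology
open Literature.AlgebraicGeometry.Resolution Literature.AlgebraicGeometry.RelativeSpec
open Summit.ResolutionOfSingularities.ResolutionOfSingularities.Theorems.WildQuotientResolution.S1
open Summit.ResolutionOfSingularities.ResolutionOfSingularities.Theorems.WildQuotientResolution.S1.NodeAtlas
open Summit.ResolutionOfSingularities.ResolutionOfSingularities.Theorems.WildQuotientResolution.S1.GoodCharts

namespace Summit.ResolutionOfSingularities.ResolutionOfSingularities.Theorems.WildQuotientResolution.S1.NpFrame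

section Fix

variable {V Y : Scheme.{u}} {r : V ⟶ Y} {G : Type u} [Group G] (ρ : ActionOver r G) (O : ρ.StableAffineOpens)

/-- `(ρ.aut g) ((ρ.aut g⁻¹) x) = x`. -/
theorem aut_base_aut_inv_base (g : G) (x : V) : (ρ.aut g).hom.base ((ρ.aut g⁻¹).hom.base x) = x := by
  rw [← Scheme.Hom.comp_apply, ← Iso.trans_hom, ← Aut.Aut_mul_def, ← map_mul, mul_inv_cancel, map_one]
  rfl

/-- Points of a `G`-stable open stay in it under the action. -/
theorem aut_base_mem (g : G) {w : V} (hw : w ∈ O.1) : (ρ.aut g).hom.base w ∈ O.1 := by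
  have : w ∈ (ρ.aut g).hom ⁻¹ᵁ O.1 := by rw [O.2.1 g]; exact hw
  exact this

/-- **If every increment `g·t − t` vanishes at `w`, then `g⁻¹ w = w`** (`O` a `G`-stable AFFINE open through `w`): membership of `w` in the basic opens
`D(t)` is then `g`-invariant, and schemes are T₀. [OURS · L1 W4.5c · (F-T5)] -/
theorem aut_inv_base_eq_of_forall_sub_mem (hO : IsAffineOpen O.1) (g : G) {w : V} (hw : w ∈ O.1)
    (h : ∀ t : Γ(V, O.1), actO ρ O g t - t ∈ idealOfPoint O.1 w hw) : (ρ.aut g⁻¹).hom.base w = w := by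
  have hgw : (ρ.aut g⁻¹).hom.base w ∈ O.1 := aut_base_mem ρ O g⁻¹ hw
  have key : ∀ t : Γ(V, O.1), (ρ.aut g⁻¹).hom.base w ∈ V.basicOpen t ↔ w ∈ V.basicOpen t := by
    intro t
    rw [← mem_basicOpen_actO_iff ρ O g t w hw, ← not_mem_idealOfPoint_iff O.1 w hw, ← not_mem_idealOfPoint_iff O.1 w hw, not_iff_not]
    constructor
    · intro ht
      have := sub_mem ht (h t)
      rwa [sub_sub_cancel] at this
    · intro ht
      have := add_mem (h t) ht
      rwa [sub_add_cancel] at this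
  by_contra hne
  obtain ⟨U, hU, hxor⟩ := exists_isOpen_xor_mem hne
  rcases hxor with ⟨h1, h2⟩ | ⟨h1, h2⟩
  · obtain ⟨t, htU, hwt⟩ := hO.exists_basicOpen_le (V := ⟨U, hU⟩) ⟨(ρ.aut g⁻¹).hom.base w, h1⟩ hgw
    exact h2 (htU ((key t).mp hwt))
  · obtain ⟨t, htU, hwt⟩ := hO.exists_basicOpen_le (V := ⟨U, hU⟩) ⟨w, h1⟩ hw
    exact h2 (htU ((key t).mpr hwt))

/-- **If every increment `g·t − t` vanishes at `w`, then `g w = w`.** [OURS · L1 W4.5c · (F-T5)] -/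
theorem aut_base_eq_of_forall_sub_mem (hO : IsAffineOpen O.1) (g : G) {w : V} (hw : w ∈ O.1)
    (h : ∀ t : Γ(V, O.1), actO ρ O g t - t ∈ idealOfPoint O.1 w hw) : (ρ.aut g).hom.base w = w := by
  have h1 := aut_inv_base_eq_of_forall_sub_mem ρ O hO g hw h
  conv_lhs => rw [← h1]
  exact aut_base_aut_inv_base ρ g w

variable {g₀ : G}

/-- In `G = ⟨g₀⟩`, every element commutes with `g₀`. -/
theorem commute_of_mem_zpowers (hG : ∀ g : G, g ∈ Subgroup.zpowers g₀) (g : G) : Commute g₀ g := by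
  obtain ⟨k, rfl⟩ := Subgroup.mem_zpowers_iff.mp (hG g)
  exact (Commute.refl g₀).zpow_right k

/-- In `G = ⟨g₀⟩`: a translate `g u` of a point not fixed by `g₀` is not fixed by `g₀`. -/
theorem aut_base_ne_of_not_fixed (hG : ∀ g : G, g ∈ Subgroup.zpowers g₀) {u : V} (hfix : (ρ.aut g₀).hom.base u ≠ u) (g : G) :
    (ρ.aut g₀).hom.base ((ρ.aut g).hom.base u) ≠ (ρ.aut g).hom.base u := by
  intro h
  apply hfix
  have h2 : (ρ.aut g₀).hom.base ((ρ.aut g).hom.base u) = (ρ.aut g).hom.base ((ρ.aut g₀).hom.base u) := by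
    rw [← Scheme.Hom.comp_apply, ← Scheme.Hom.comp_apply, ← Iso.trans_hom, ← Iso.trans_hom, ← Aut.Aut_mul_def, ← Aut.Aut_mul_def,
      ← map_mul, ← map_mul, (commute_of_mem_zpowers hG g).eq]
  rw [h2] at h
  have h3 := congrArg (fun x => (ρ.aut g⁻¹).hom.base x) h
  simp only at h3
  have e1 : ∀ x : V, (ρ.aut g⁻¹).hom.base ((ρ.aut g).hom.base x) = x := fun x => by
    simpa only [inv_inv] using aut_base_aut_inv_base ρ g⁻¹ x
  rwa [e1, e1] at h3

/-- **An invariant section in the increment ideal, invertible at a non-fixed point.** For `G = ⟨g₀⟩` finite, `O` a `G`-stable affine open and `u ∈ O`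
NOT fixed by `g₀`: some `G`-INVARIANT `b ∈ (g₀·t − t : t)` has `u ∈ D(b)` — prime avoidance over the (finite) orbit of `u`, none of whose points is
fixed, then the norm `Π_g g·c`. [OURS · L1 W4.5c · (F-T5)] -/
theorem exists_invariant_mem_incrementIdeal [Finite G] (hG : ∀ g : G, g ∈ Subgroup.zpowers g₀) (hO : IsAffineOpen O.1) {u : V} (hu : u ∈ O.1)
    (hfix : (ρ.aut g₀).hom.base u ≠ u) :
    ∃ b : Γ(V, O.1), (∀ g : G, actO ρ O g b = b) ∧ u ∈ V.basicOpen b ∧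
      b ∈ Ideal.span (Set.range fun t : Γ(V, O.1) => actO ρ O g₀ t - t) := by
  classical
  letI := Fintype.ofFinite G
  set I : Ideal Γ(V, O.1) := Ideal.span (Set.range fun t : Γ(V, O.1) => actO ρ O g₀ t - t) with hI
  have horbO : ∀ g : G, (ρ.aut g).hom.base u ∈ O.1 := fun g => aut_base_mem ρ O g hu
  -- `I ⊄ 𝔭_{g u}` for every `g`
  have hnot : ∀ g : G, ¬ I ≤ idealOfPoint O.1 ((ρ.aut g).hom.base u) (horbO g) := by
    intro g hle
    refine aut_base_ne_of_not_fixed ρ hG hfix g (aut_base_eq_of_forall_sub_mem ρ O hO g₀ (horbO g) fun t => hle ?_)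
    exact Ideal.subset_span ⟨t, rfl⟩
  -- prime avoidance over the orbit
  have havoid : ∃ c ∈ I, ∀ g : G, c ∉ idealOfPoint O.1 ((ρ.aut g).hom.base u) (horbO g) := by
    by_contra hcon
    push Not at hcon
    have hsub : ((I : Ideal Γ(V, O.1)) : Set Γ(V, O.1)) ⊆
        ⋃ g ∈ (↑(Finset.univ : Finset G) : Set G), (idealOfPoint O.1 ((ρ.aut g).hom.base u) (horbO g) : Set Γ(V, O.1)) := by
      intro c hc
      obtain ⟨g, hg⟩ := hcon c hc
      exact Set.mem_iUnion₂.mpr ⟨g, Finset.mem_univ g, hg⟩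
    obtain ⟨g, -, hle⟩ := (Ideal.subset_union_prime (1 : G) (1 : G) fun g _ _ _ =>
      isPrime_idealOfPoint O.1 ((ρ.aut g).hom.base u) (horbO g)).mp hsub
    exact hnot g hle
  obtain ⟨c, hcI, hcu⟩ := havoid
  -- the norm
  refine ⟨∏ g : G, actO ρ O g c, fun g => ?_, ?_, ?_⟩
  · rw [map_prod]
    simp_rw [actO_actO]
    exact Fintype.prod_equiv (Equiv.mulLeft g) _ _ fun h => rfl
  · rw [V.mem_basicOpen _ u hu, map_prod]
    refine Finset.prod_induction _ IsUnit (fun _ _ => IsUnit.mul) isUnit_one fun g _ => ?_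
    rw [← V.mem_basicOpen _ u hu, mem_basicOpen_actO_iff ρ O g c u hu, ← not_mem_idealOfPoint_iff O.1 _ (horbO g⁻¹)]
    exact hcu g⁻¹
  · have h1 : actO ρ O 1 c ∣ ∏ g : G, actO ρ O g c := Finset.dvd_prod_of_mem _ (Finset.mem_univ (1 : G))
    rw [actO_one] at h1
    exact Ideal.mem_of_dvd _ h1 hcI

end Fix

/-! ## (F-T5) for node data and atlases -/

section Atlas

variable {p : ℕ} {V Y : Scheme.{u}} {q : V ⟶ Y} {G : Type u} [Group G] {ρ : ActionOver q G} {g₀ : G}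

/-- ★ **Every node chart through a NON-FIXED point is principal near it.** With `b` invariant, `u ∈ D(b)` and `b` in the increment ideal of `g₀`
(`exists_invariant_mem_incrementIdeal`), `e b` lies in the augmentation ideal of the node ring (`intertwine`), so the augmentation ideal becomes `(1)`
after inverting `e b`. [OURS · L1 W4.5c · (F-T5)] -/
theorem NodeData.principalNear_of_not_fixed [Finite G] (hG : ∀ g : G, g ∈ Subgroup.zpowers g₀) {O : ρ.StableAffineOpens} (D : NodeData p ρ g₀ O)
    {u : V} (hu : u ∈ O.1) (hfix : (ρ.aut g₀).hom.base u ≠ u) : D.PrincipalNear u := by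
  letI := D.instCommRing
  letI := D.instGradedRing
  obtain ⟨b, hb, hub, hbI⟩ := exists_invariant_mem_incrementIdeal ρ O hG D.affine hu hfix
  refine ⟨b, hb, hub, ?_⟩
  -- `e` followed by the inclusion `𝒜 0 ⊆ B`, as a ring hom
  let φ : Γ(V, O.1) →+* D.B := (SetLike.GradeZero.subring D.𝒜).subtype.comp (D.e : Γ(V, O.1) →+* ↥(D.𝒜 0))
  have hφ : ∀ t, φ t = ((D.e t : ↥(D.𝒜 0)) : D.B) := fun _ => rfl
  -- the increment ideal maps into the augmentation ideal
  have hmap : Ideal.map φ (Ideal.span (Set.range fun t : Γ(V, O.1) => actO ρ O g₀ t - t)) ≤ augmentationIdeal D.σ := by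
    rw [Ideal.map_span, Ideal.span_le]
    rintro _ ⟨_, ⟨t, rfl⟩, rfl⟩
    rw [map_sub, hφ, hφ, D.intertwine t]
    exact sub_mem_augmentationIdeal D.σ _
  have hbaug : ((D.e b : ↥(D.𝒜 0)) : D.B) ∈ augmentationIdeal D.σ := by
    rw [← hφ]; exact hmap (Ideal.mem_map_of_mem φ hbI)
  -- a unit in the localisation ⇒ the extended ideal is `(1)`
  have htop : (augmentationIdeal D.σ).map (algebraMap D.B (Localization.Away ((D.e b : ↥(D.𝒜 0)) : D.B))) = ⊤ := by
    rw [Ideal.eq_top_iff_one]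
    have hu' : IsUnit (algebraMap D.B (Localization.Away ((D.e b : ↥(D.𝒜 0)) : D.B)) ((D.e b : ↥(D.𝒜 0)) : D.B)) :=
      IsLocalization.Away.algebraMap_isUnit _
    obtain ⟨v, hv⟩ := hu'.exists_left_inv
    rw [← hv]
    exact Ideal.mul_mem_left _ v (Ideal.mem_map_of_mem _ hbaug)
  rw [htop]
  exact ⟨⟨1, by rw [Ideal.submodule_span_eq, Ideal.span_singleton_one]⟩⟩

/-- ★ **(F-T5) `F_𝔄 ⊆ Fix(g₀)`** for EVERY node atlas datum (`G = ⟨g₀⟩` finite): the carried formal locus lies in the fixed-point set of `g₀`.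
[OURS · L1 W4.5c · plan-1 R-F15 (2) (F-T5)] -/
theorem NodeAtlasData.fLocus_subset_fixedPoints [Finite G] (hG : ∀ g : G, g ∈ Subgroup.zpowers g₀) (𝔄 : NodeAtlasData p ρ g₀) :
    𝔄.fLocus ⊆ {u | (ρ.aut g₀).hom.base u = u} := by
  intro u hu
  by_contra hfix
  obtain ⟨i, hi⟩ := 𝔄.cover u
  exact hu i hi ((𝔄.D i).principalNear_of_not_fixed hG hi hfix)

/-- The contrapositive: a point moved by `g₀` is not in the carried formal locus. -/
theorem NodeAtlasData.not_mem_fLocus_of_not_fixed [Finite G] (hG : ∀ g : G, g ∈ Subgroup.zpowers g₀) (𝔄 : NodeAtlasData p ρ g₀) {u : V}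
    (hfix : (ρ.aut g₀).hom.base u ≠ u) : u ∉ 𝔄.fLocus :=
  fun hu => hfix (𝔄.fLocus_subset_fixedPoints hG hu)

/-- A FREE action (no `g₀`-fixed point) has empty carried formal locus for every atlas. -/
theorem NodeAtlasData.fLocus_eq_empty_of_forall_not_fixed [Finite G] (hG : ∀ g : G, g ∈ Subgroup.zpowers g₀) (𝔄 : NodeAtlasData p ρ g₀)
    (hfree : ∀ u : V, (ρ.aut g₀).hom.base u ≠ u) : 𝔄.fLocus = ∅ :=
  Set.eq_empty_iff_forall_notMem.mpr fun u => 𝔄.not_mem_fLocus_of_not_fixed hG (hfree u)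

end Atlas

end Summit.ResolutionOfSingularities.ResolutionOfSingularities.Theorems.WildQuotientResolution.S1.NpFrame

end
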